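import Summits.BirchSwinnertonDyer.BirchSwinnertonDyer.Theorems.Rank1ResidualX9TwistedImGL2
import Literature.NumberTheory.GaloisRepresentations.GL2F5OrderThree
import HarnessLib

/-!
# Class X9, twisted hypothesis (im): the `GL₂(𝔽_p)` lemma, II (`p = 5`, and all `p ≥ 5`)

HONEST FRAMING (cell `b2b-bsdres`, X9 prover lineage): pure group theory in `GL₂(𝔽_p)` serving
the kernel proof of the obligation node
`Summit.BirchSwinnertonDyer.BirchSwinnertonDyer.Rank1Residual.X9TwistedHypothesisIm`
(`Theorems/Rank1ResidualX9SmallImageKolyvagin`, cell `bsd-smallim`).  Nothing here is about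
elliptic curves; no class-level claim is made.  Sequel of `Rank1ResidualX9TwistedImGL2` (`p ≠ 5`).

**Theorem** (`exists_det_one_eigenvalue_sq_ne_one`).  Let `p ≥ 5` and let `G ⊆ GL₂(𝔽_p)` be a
proper subgroup containing a split half-Cartan subgroup `P (1 0; 0 *) P⁻¹` and acting irreducibly
on `𝔽_p²`.  Then some `h ∈ G` has `det h = 1` and an eigenvector `v ≠ 0` with `h v = a v`,
`a ∈ 𝔽_pˣ`, `a² ≠ 1`.

Proof of the case `p = 5` (`exists_det_one_eigenvalue_sq_ne_one_five`; at `p = 5` Serre's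
Prop. 17 does not apply to a half-Cartan subgroup of order `4`, and the exceptional image `5S4`
does occur, e.g. `2268b1`).  With `H = G ∩ SL₂(𝔽₅)`, `#G = 4 · #H` (the half-Cartan subgroup
makes `det` onto `𝔽₅ˣ`), `5 ∤ #G ∣ 480` (Prop. 15: otherwise `G` is Borel or everything), so
`#H ∣ 24`.  If `4 ∣ #H`, a subgroup of order `4` of `H` (Sylow) contains `h` with `h² ≠ 1` (the
only involution of `SL₂(𝔽₅)` is `-1`, `coe_eq_one_or_eq_neg_one_of_mul_self_eq_one`), so
`h² = -1`, `(h - 2)(h - 3) = 0`, and a non-zero column of `h - 3` is an eigenvector of `h` for the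
eigenvalue `2`, `2² ≠ 1` (`exists_mulVec_eq_two_smul`).  If `#H ∈ {1, 2}` then `H ⊆ {±1}` and
`G ⊆ ±P (1 0; 0 *) P⁻¹` fixes a line.  If `#H ∈ {3, 6}`, an element `x ∈ H` of order `3`
generates the only subgroup of order `3` of `H` (`mem_zpowers_of_orderOf_eq_three`), so every
`G`-conjugate of `x` is a power of `x` and `G` normalises the Cartan subgroup `𝔽₅[x]ˣ`
(`mem_normalizer_unitGroup_adjoinElem_of_conj_mem`; `x` is non-scalar of trace `-1`,
discriminant `-3 ≠ 0`); Prop. 14 makes it the split Cartan subgroup of `P` and the swap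
construction (`exists_mem_det_eq_one_mulVec_eq`) concludes.

References: J.-P. Serre, Invent. Math. 15 (1972), §2.2 Prop. 14, §2.4 Prop. 15, §2.7 Prop. 17 [Serre1972].
-/

open Matrix
open scoped MatrixGroups

-- the summit and its single problem are both named `BirchSwinnertonDyer` (registry layout D-0017)
set_option linter.dupNamespace false
namespace Summit.BirchSwinnertonDyer.BirchSwinnertonDyer.Rank1Residual.TwistedIm

open Literature.NumberTheory.GaloisRepresentations
open Literature.NumberTheory.GaloisRepresentations.GL2
open Literature.NumberTheory.GaloisRepresentations.Serre1972

section Five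

-- `Fact (Nat.Prime 5)` is the global instance `GL2F5OrderThree.instFactNatPrimeFive`.
open Literature.NumberTheory.GaloisRepresentations.GL2F5OrderThree (card_GL_fin_two_zmod_five)

/-- `-1 ≠ 1` in `GL₂(𝔽₅)`. [folklore] -/
theorem neg_one_ne_one_GL_two_zmod_five : (-1 : GL (Fin 2) (ZMod 5)) ≠ 1 := by
  intro h
  have h' : ((-1 : GL (Fin 2) (ZMod 5)) : Matrix (Fin 2) (Fin 2) (ZMod 5)) 0 0 =
      ((1 : GL (Fin 2) (ZMod 5)) : Matrix (Fin 2) (Fin 2) (ZMod 5)) 0 0 := by rw [h]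
  rw [Units.val_neg, Units.val_one, Matrix.neg_apply, Matrix.one_apply_eq] at h'
  exact absurd h' (by decide)

/-- An element of `SL₂(𝔽₅)` with `h² = -1` has the eigenvalue `2` (`h² + 1 = (h - 2)(h - 3)` in
characteristic `5`). [folklore] -/
theorem exists_mulVec_eq_two_smul {h : GL (Fin 2) (ZMod 5)}
    (hdet : Matrix.det (h : Matrix (Fin 2) (Fin 2) (ZMod 5)) = 1)
    (hh : (h : Matrix (Fin 2) (Fin 2) (ZMod 5)) * h = -1) :
    ∃ v : Fin 2 → ZMod 5, v ≠ 0 ∧ (h : Matrix (Fin 2) (Fin 2) (ZMod 5)) *ᵥ v = (2 : ZMod 5) • v := by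
  set N : Matrix (Fin 2) (Fin 2) (ZMod 5) := (h : Matrix (Fin 2) (Fin 2) (ZMod 5)) - (3 : ZMod 5) • 1
    with hN
  have hprod : ((h : Matrix (Fin 2) (Fin 2) (ZMod 5)) - (2 : ZMod 5) • 1) * N = 0 := by
    have h5 : (5 : ZMod 5) = 0 := by decide
    have h6 : (6 : ZMod 5) = 1 := by decide
    rw [hN, Matrix.sub_mul, Matrix.mul_sub, Matrix.mul_sub, hh, Matrix.mul_smul, Matrix.mul_one,
      Matrix.smul_mul, Matrix.one_mul, Matrix.smul_mul, Matrix.one_mul, smul_smul]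
    have : -1 - (3 : ZMod 5) • (h : Matrix (Fin 2) (Fin 2) (ZMod 5)) -
        ((2 : ZMod 5) • (h : Matrix (Fin 2) (Fin 2) (ZMod 5)) - (2 * 3 : ZMod 5) • 1) =
        -(5 : ZMod 5) • (h : Matrix (Fin 2) (Fin 2) (ZMod 5)) +
          ((6 : ZMod 5) - 1) • (1 : Matrix (Fin 2) (Fin 2) (ZMod 5)) := by
      norm_num
      module
    rw [this, h5, h6, neg_zero, zero_smul, zero_add, sub_self, zero_smul]
  have hN0 : N ≠ 0 := by
    intro h0
    have h3 : (h : Matrix (Fin 2) (Fin 2) (ZMod 5)) = (3 : ZMod 5) • 1 := sub_eq_zero.mp h0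
    rw [h3, Matrix.det_smul, Matrix.det_one, mul_one, Fintype.card_fin] at hdet
    exact absurd hdet (by decide)
  -- a non-zero column of `N` is an eigenvector for `2`
  obtain ⟨j, hj⟩ : ∃ j, N.col j ≠ 0 := by
    by_contra hall
    push Not at hall
    apply hN0
    ext i j
    have := congrFun (hall j) i
    rwa [Matrix.col_apply] at this
  refine ⟨N.col j, hj, ?_⟩
  have hcol : ((h : Matrix (Fin 2) (Fin 2) (ZMod 5)) - (2 : ZMod 5) • 1) *ᵥ N.col j = 0 := by
    rw [← mulVec_single_one, mulVec_mulVec, hprod, Matrix.zero_mulVec]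
  rw [Matrix.sub_mulVec, Matrix.smul_mulVec, Matrix.one_mulVec, sub_eq_zero] at hcol
  exact hcol

/-- **Case `p = 5`.** [folklore] -/
theorem exists_det_one_eigenvalue_sq_ne_one_five (G : Subgroup (GL (Fin 2) (ZMod 5)))
    {P : GL (Fin 2) (ZMod 5)} (hPG : halfSplitCartan P ≤ G)
    (hirr : ∀ (v : Fin 2 → ZMod 5) (hv : v ≠ 0), ¬ G ≤ eigenvectorStabilizer v hv)
    (hG : G ≠ ⊤) :
    ∃ h ∈ G, Matrix.GeneralLinearGroup.det h = 1 ∧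
      ∃ (a : (ZMod 5)ˣ) (v : Fin 2 → ZMod 5), v ≠ 0 ∧ a ^ 2 ≠ 1 ∧
        (h : Matrix (Fin 2) (Fin 2) (ZMod 5)) *ᵥ v = (a : ZMod 5) • v := by
  classical
  have hp5 : 5 ≤ 5 := le_rfl
  have h2 : (2 : ZMod 5) ≠ 0 := by decide
  have hF : ∃ u : (ZMod 5)ˣ, u ≠ 1 := exists_units_ne_one (p := 5) (by decide)
  have hdet : ∀ u : (ZMod 5)ˣ, ∃ g ∈ G, Matrix.GeneralLinearGroup.det g = u := fun u ↦ by
    obtain ⟨g, hg, hgu⟩ := exists_mem_halfSplitCartan_det_eq P u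
    exact ⟨g, hPG hg, hgu⟩
  have h5G : ¬ 5 ∣ Nat.card G := by
    intro hdvd
    rcases eq_top_or_borel_of_dvd_card G hdvd hdet with h | ⟨v, hv, hB⟩
    · exact hG h
    · exact hirr v hv hB
  -- the elements of `G` of determinant `1`
  set f : G →* (ZMod 5)ˣ := (Matrix.GeneralLinearGroup.det).comp G.subtype with hf
  have hfsurj : Function.Surjective f := fun u ↦ by
    obtain ⟨g, hg, hgu⟩ := hdet u
    exact ⟨⟨g, hg⟩, hgu⟩
  set H : Subgroup (GL (Fin 2) (ZMod 5)) := f.ker.map G.subtype with hH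
  have hmemH : ∀ g, g ∈ H ↔ g ∈ G ∧ Matrix.GeneralLinearGroup.det g = 1 := by
    intro g
    rw [hH, Subgroup.mem_map]
    constructor
    · rintro ⟨x, hx, rfl⟩
      exact ⟨x.2, hx⟩
    · rintro ⟨hg, hg1⟩
      exact ⟨⟨g, hg⟩, hg1, rfl⟩
  have hHG : H ≤ G := fun g hg ↦ ((hmemH g).mp hg).1
  have hcardH : Nat.card H = Nat.card f.ker :=
    Subgroup.card_map_of_injective (Subgroup.subtype_injective G)
  have hcardG : Nat.card G = 4 * Nat.card H := by
    rw [Subgroup.card_eq_card_quotient_mul_card_subgroup f.ker, hcardH,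
      Nat.card_congr (QuotientGroup.quotientKerEquivOfSurjective f hfsurj).toEquiv,
      Nat.card_eq_fintype_card, ZMod.card_units]
  -- `#H ∣ 24`
  have hH24 : Nat.card H ∣ 24 := by
    have hG480 : Nat.card G ∣ 480 := card_GL_fin_two_zmod_five ▸ Subgroup.card_subgroup_dvd_card G
    rw [hcardG] at hG480
    have h120 : Nat.card H ∣ 24 * 5 := by
      have h4 : 4 * Nat.card H ∣ 4 * (24 * 5) := by
        rw [show (4 : ℕ) * (24 * 5) = 480 by norm_num]; exact hG480
      exact Nat.dvd_of_mul_dvd_mul_left (by norm_num) h4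
    have hcop : (Nat.card H).Coprime 5 := by
      rw [Nat.coprime_comm, Nat.Prime.coprime_iff_not_dvd Nat.prime_five]
      intro h5
      exact h5G (hcardG ▸ dvd_mul_of_dvd_right h5 4)
    exact hcop.dvd_of_dvd_mul_right h120
  -- elements of `H`: determinant `1`, and `q² = 1 ⇒ q = ±1`
  have hpm : ∀ q ∈ H, q * q = 1 → q = 1 ∨ q = -1 := by
    intro q hq hqq
    have hqdet : Matrix.det (q : Matrix (Fin 2) (Fin 2) (ZMod 5)) = 1 := by
      rw [← Matrix.GeneralLinearGroup.val_det_apply, ((hmemH q).mp hq).2, Units.val_one]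
    rcases coe_eq_one_or_eq_neg_one_of_mul_self_eq_one h2 hqdet hqq with h1 | h1
    · exact Or.inl (Units.ext h1)
    · exact Or.inr (Units.ext (by rw [h1, Units.val_neg, Units.val_one]))
  by_cases h4 : 4 ∣ Nat.card H
  · -- a subgroup of order `4` of `H` contains an element of order `4`
    have h4' : 2 ^ 2 ∣ Nat.card H := by rw [show (2 : ℕ) ^ 2 = 4 by norm_num]; exact h4
    obtain ⟨Q, hQ⟩ := Sylow.exists_subgroup_card_pow_prime (G := H) 2 h4'
    have hQ4 : Nat.card Q = 4 := by rw [hQ]; norm_num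
    obtain ⟨q, hqq⟩ : ∃ q : Q, (q : H) * q ≠ 1 := by
      by_contra hall
      push Not at hall
      -- then `Q ⊆ {±1}`, contradicting `#Q = 4`
      have hval : ∀ q : Q, ((q : H) : GL (Fin 2) (ZMod 5)) = 1 ∨
          ((q : H) : GL (Fin 2) (ZMod 5)) = -1 := fun q ↦
        hpm _ (q : H).2 (by rw [← Subgroup.coe_mul, hall q, Subgroup.coe_one])
      let φ : Q → Bool := fun q ↦ decide (((q : H) : GL (Fin 2) (ZMod 5)) = 1)
      have hφ : Function.Injective φ := by
        intro q q' hqq'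
        apply Subtype.ext
        apply Subtype.ext
        simp only [φ, decide_eq_decide] at hqq'
        rcases hval q with h1 | h1 <;> rcases hval q' with h1' | h1'
        · rw [h1, h1']
        · exact absurd (hqq'.mp h1) (by rw [h1']; exact neg_one_ne_one_GL_two_zmod_five)
        · exact absurd (hqq'.mpr h1') (by rw [h1]; exact neg_one_ne_one_GL_two_zmod_five)
        · rw [h1, h1']
      have hle := Nat.card_le_card_of_injective φ hφ
      rw [hQ4, Nat.card_eq_fintype_card, Fintype.card_bool] at hle
      omega
    -- `h = q` has `h² = -1`
    set hq : GL (Fin 2) (ZMod 5) := ((q : H) : GL (Fin 2) (ZMod 5)) with hhq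
    have hqH : hq ∈ H := (q : H).2
    have hq4 : hq ^ 4 = 1 := by
      have := pow_card_eq_one' (x := q)
      rw [hQ4] at this
      rw [hhq, ← Subgroup.coe_pow, ← Subgroup.coe_pow, this, Subgroup.coe_one, Subgroup.coe_one]
    have hq2 : hq * hq = -1 := by
      have hmem : hq * hq ∈ H := H.mul_mem hqH hqH
      have hsq : (hq * hq) * (hq * hq) = 1 := by
        rw [← hq4]; simp only [pow_succ, pow_zero, one_mul, mul_assoc]
      rcases hpm _ hmem hsq with h1 | h1
      · exfalso
        apply hqq
        rw [← Subgroup.coe_mul] at h1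
        exact Subtype.ext h1
      · exact h1
    have hqdet : Matrix.GeneralLinearGroup.det hq = 1 := ((hmemH hq).mp hqH).2
    have hqdet' : Matrix.det (hq : Matrix (Fin 2) (Fin 2) (ZMod 5)) = 1 := by
      rw [← Matrix.GeneralLinearGroup.val_det_apply, hqdet, Units.val_one]
    obtain ⟨v, hv, hev⟩ := exists_mulVec_eq_two_smul hqdet'
      (by rw [← Units.val_mul, hq2, Units.val_neg, Units.val_one])
    refine ⟨hq, hHG hqH, hqdet, Units.mkOfMulEqOne 2 3 (by decide), v, hv, by decide, ?_⟩
    rw [Units.val_mkOfMulEqOne]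
    exact hev
  · by_cases h3 : 3 ∣ Nat.card H
    · -- `#H ∈ {3, 6}`: an element `x` of order `3`; `G` normalises `𝔽₅[x]ˣ`
      haveI : Fact (Nat.Prime 3) := ⟨Nat.prime_three⟩
      have hHlt : Nat.card H < 9 := by
        have hle : Nat.card H ≤ 24 := Nat.le_of_dvd (by norm_num) hH24
        interval_cases hc : Nat.card H <;> omega
      obtain ⟨x, hx⟩ := exists_prime_orderOf_dvd_card' 3 h3
      set x₀ : GL (Fin 2) (ZMod 5) := (x : GL (Fin 2) (ZMod 5)) with hx₀
      have hx₀H : x₀ ∈ H := x.2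
      have hx₀3 : x₀ ^ 3 = 1 := by
        rw [hx₀, ← Subgroup.coe_pow, ← hx, pow_orderOf_eq_one, Subgroup.coe_one]
      have hx₀1 : x₀ ≠ 1 := by
        intro h1
        have : orderOf x = 1 := by
          rw [← Subgroup.orderOf_coe, ← hx₀, h1, orderOf_one]
        omega
      have hx₀det : Matrix.det (x₀ : Matrix (Fin 2) (Fin 2) (ZMod 5)) = 1 := by
        rw [← Matrix.GeneralLinearGroup.val_det_apply, ((hmemH x₀).mp hx₀H).2, Units.val_one]
      -- `x₀` is not scalar
      have hxs : ∀ c : ZMod 5, (x₀ : Matrix (Fin 2) (Fin 2) (ZMod 5)) ≠ c • 1 := by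
        intro c hc
        have hc2 : c ^ 2 = 1 := by
          have h := hx₀det
          rwa [hc, Matrix.det_smul, Matrix.det_one, mul_one, Fintype.card_fin] at h
        have hc3 : c ^ 3 = 1 := by
          have h := congrArg (fun g : GL (Fin 2) (ZMod 5) ↦ (g : Matrix (Fin 2) (Fin 2) (ZMod 5)) 0 0)
            hx₀3
          simp only [Units.val_pow_eq_pow_val, hc, smul_pow, one_pow, Matrix.smul_apply,
            Matrix.one_apply_eq, Units.val_one, smul_eq_mul, mul_one] at h
          exact h
        have hc1 : c = 1 := by
          have key : ∀ d : ZMod 5, d ^ 2 = 1 → d ^ 3 = 1 → d = 1 := by decide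
          exact key c hc2 hc3
        apply hx₀1
        exact Units.ext (by rw [hc, hc1, one_smul, Units.val_one])
      -- its trace is `-1`, so its discriminant is non-zero
      have htr : (x₀ : Matrix (Fin 2) (Fin 2) (ZMod 5)).trace = -1 := by
        set t := (x₀ : Matrix (Fin 2) (Fin 2) (ZMod 5)).trace with ht
        have hch := cayley_hamilton_two (x₀ : Matrix (Fin 2) (Fin 2) (ZMod 5))
        rw [hx₀det, one_smul, ← ht] at hch
        have hcube : (x₀ : Matrix (Fin 2) (Fin 2) (ZMod 5)) * x₀ * x₀ = 1 := by
          rw [← Units.val_mul, ← Units.val_mul, ← pow_three', hx₀3, Units.val_one]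
        -- `x₀³ = (t² - 1) x₀ - t`
        have hkey : (t * t - 1) • (x₀ : Matrix (Fin 2) (Fin 2) (ZMod 5)) =
            (1 + t) • (1 : Matrix (Fin 2) (Fin 2) (ZMod 5)) := by
          have h1 : (x₀ : Matrix (Fin 2) (Fin 2) (ZMod 5)) * x₀ * x₀ =
              (t * t - 1) • (x₀ : Matrix (Fin 2) (Fin 2) (ZMod 5)) - t • 1 := by
            rw [hch, Matrix.sub_mul, Matrix.smul_mul, Matrix.one_mul, hch]
            module
          rw [hcube] at h1
          calc (t * t - 1) • (x₀ : Matrix (Fin 2) (Fin 2) (ZMod 5))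
              = ((t * t - 1) • (x₀ : Matrix (Fin 2) (Fin 2) (ZMod 5)) - t • 1) + t • 1 := by
                rw [sub_add_cancel]
            _ = (1 + t) • 1 := by rw [← h1]; module
        by_contra hne
        by_cases htt : t * t - 1 = 0
        · rw [htt, zero_smul] at hkey
          have h00 := congrFun (congrFun hkey 0) 0
          simp only [Matrix.zero_apply, Matrix.smul_apply, Matrix.one_apply_eq, smul_eq_mul,
            mul_one] at h00
          have : t = 1 ∨ t = -1 := by
            have : (t - 1) * (t + 1) = 0 := by rw [← htt]; ring
            rcases mul_eq_zero.mp this with h | h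
            · exact Or.inl (sub_eq_zero.mp h)
            · exact Or.inr (eq_neg_of_add_eq_zero_left h)
          rcases this with h | h
          · rw [h] at h00
            exact absurd h00.symm (by decide)
          · exact hne h
        · apply hxs ((1 + t) / (t * t - 1))
          calc (x₀ : Matrix (Fin 2) (Fin 2) (ZMod 5))
              = (t * t - 1)⁻¹ • ((t * t - 1) • (x₀ : Matrix (Fin 2) (Fin 2) (ZMod 5))) := by
                rw [smul_smul, inv_mul_cancel₀ htt, one_smul]
            _ = ((1 + t) / (t * t - 1)) • 1 := by rw [hkey, smul_smul, div_eq_inv_mul]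
      have hdisc : (x₀ : Matrix (Fin 2) (Fin 2) (ZMod 5)).trace ^ 2 -
          4 * (x₀ : Matrix (Fin 2) (Fin 2) (ZMod 5)).det ≠ 0 := by
        rw [htr, hx₀det]; decide
      have hC : unitGroup (adjoinElem (x₀ : Matrix (Fin 2) (Fin 2) (ZMod 5))) ∈
          cartanSubgroups (ZMod 5) := unitGroup_adjoinElem_mem_cartanSubgroups hxs hdisc
      -- every conjugate of `x₀` by `G` lies in `𝔽₅[x₀]`
      have hconj : ∀ g ∈ G, ((g * x₀ * g⁻¹ : GL (Fin 2) (ZMod 5)) :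
          Matrix (Fin 2) (Fin 2) (ZMod 5)) ∈ adjoinElem (x₀ : Matrix (Fin 2) (Fin 2) (ZMod 5)) := by
        intro g hg
        have hmem : g * x₀ * g⁻¹ ∈ H := by
          rw [hmemH]
          refine ⟨G.mul_mem (G.mul_mem hg (hHG hx₀H)) (G.inv_mem hg), ?_⟩
          rw [map_mul, map_mul, map_inv, ((hmemH x₀).mp hx₀H).2, mul_one, mul_inv_cancel]
        have hy3 : orderOf (⟨g * x₀ * g⁻¹, hmem⟩ : H) = 3 := by
          rw [Subgroup.orderOf_mk]
          refine orderOf_eq_prime ?_ ?_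
          · rw [conj_pow, hx₀3, mul_one, mul_inv_cancel]
          · intro h1
            apply hx₀1
            rw [mul_inv_eq_one, mul_eq_left] at h1
            exact h1
        have hyx := mem_zpowers_of_orderOf_eq_three hx hy3 hHlt
        rw [mem_zpowers_iff_mem_range_orderOf, Finset.mem_image] at hyx
        obtain ⟨n, -, hn⟩ := hyx
        have hval : ((g * x₀ * g⁻¹ : GL (Fin 2) (ZMod 5)) : Matrix (Fin 2) (Fin 2) (ZMod 5)) =
            (x₀ : Matrix (Fin 2) (Fin 2) (ZMod 5)) ^ n := by
          have := congrArg (fun z : H ↦ ((z : GL (Fin 2) (ZMod 5)) : Matrix (Fin 2) (Fin 2) (ZMod 5))) hn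
          simp only [Subgroup.coe_pow, Units.val_pow_eq_pow_val] at this
          rw [← this]
        rw [hval]
        exact Subalgebra.pow_mem _ (self_mem_adjoinElem _) n
      have hGN : G ≤ Subgroup.normalizer
          (unitGroup (adjoinElem (x₀ : Matrix (Fin 2) (Fin 2) (ZMod 5))) :
            Set (GL (Fin 2) (ZMod 5))) := by
        intro g hg
        refine mem_normalizer_unitGroup_adjoinElem_of_conj_mem hxs (hconj g hg) ?_
        have := hconj g⁻¹ (G.inv_mem hg)
        rwa [inv_inv] at this
      -- Prop. 14: the Cartan subgroup is the split one of `P`; then the swap construction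
      have hCP := eq_splitCartan_of_halfSplitCartan_le_normalizer hC hp5 (hPG.trans hGN)
      rw [hCP] at hGN
      have hGC : ¬ G ≤ splitCartan P := fun h ↦
        hirr _ (col_ne_zero P 0) (h.trans (splitCartan_le_eigenvectorStabilizer P))
      obtain ⟨h, hhG, hhdet, hv⟩ :=
        exists_mem_det_eq_one_mulVec_eq hF hPG hGN hGC (Units.mkOfMulEqOne 2 3 (by decide))
      refine ⟨h, hhG, hhdet, (Units.mkOfMulEqOne 2 3 (by decide))⁻¹, _, col_ne_zero P 1,
        by decide, hv⟩
    · -- `#H ∈ {1, 2}`: `H ⊆ {±1}` and `G` fixes the first line of `P`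
      have hH2 : Nat.card H ∣ 2 := by
        have hle : Nat.card H ≤ 24 := Nat.le_of_dvd (by norm_num) hH24
        interval_cases hc : Nat.card H <;> omega
      exfalso
      apply hirr _ (col_ne_zero P 0)
      intro g hg
      set u := Matrix.GeneralLinearGroup.det g with hu
      have hd : P * halfDiagonalHom u * P⁻¹ ∈ G :=
        hPG ⟨halfDiagonalHom u, by rw [← range_halfDiagonalHom]; exact ⟨u, rfl⟩, by
          rw [MulEquiv.coe_toMonoidHom, MulAut.conj_apply]⟩
      have hdC : P * halfDiagonalHom u * P⁻¹ ∈ splitCartan P :=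
        halfSplitCartan_le_splitCartan P ⟨halfDiagonalHom u, by
          rw [← range_halfDiagonalHom]; exact ⟨u, rfl⟩, by
          rw [MulEquiv.coe_toMonoidHom, MulAut.conj_apply]⟩
      set k : GL (Fin 2) (ZMod 5) := g * (P * halfDiagonalHom u * P⁻¹)⁻¹ with hk
      have hkH : k ∈ H := by
        rw [hmemH]
        refine ⟨G.mul_mem hg (G.inv_mem hd), ?_⟩
        rw [hk, map_mul, map_inv, map_mul, map_mul, map_inv, det_halfDiagonalHom,
          mul_inv_cancel_comm, ← hu, mul_inv_cancel]
      have hkk : k * k = 1 := by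
        have h1 : (⟨k, hkH⟩ : H) ^ Nat.card H = 1 := pow_card_eq_one'
        obtain ⟨m, hm⟩ := hH2
        have h2 : (⟨k, hkH⟩ : H) ^ 2 = 1 := by
          calc (⟨k, hkH⟩ : H) ^ 2 = (⟨k, hkH⟩ : H) ^ (Nat.card H * m) := by rw [← hm]
            _ = 1 := by rw [pow_mul, h1, one_pow]
        have h3 := congrArg (fun z : H ↦ (z : GL (Fin 2) (ZMod 5))) h2
        simpa [pow_two] using h3
      have hgk : g = k * (P * halfDiagonalHom u * P⁻¹) := by rw [hk]; group
      rw [hgk]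
      refine Subgroup.mul_mem _ ?_ (splitCartan_le_eigenvectorStabilizer P hdC)
      rw [mem_eigenvectorStabilizer_iff]
      rcases hpm k hkH hkk with h1 | h1
      · exact ⟨1, by rw [h1, Units.val_one, Matrix.one_mulVec, one_smul]⟩
      · exact ⟨-1, by rw [h1, Units.val_neg, Units.val_one, Matrix.neg_mulVec, Matrix.one_mulVec,
          neg_one_smul]⟩

end Five

section Prime

variable {p : ℕ} [Fact p.Prime]

/-- **The `GL₂(𝔽_p)` lemma of the twisted hypothesis (im), all `p ≥ 5`.**  A proper subgroup
`G ⊊ GL₂(𝔽_p)` containing a split half-Cartan subgroup and fixing no line contains an element `h`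
of determinant `1` with an `𝔽_p`-rational eigenvalue `a`, `a² ≠ 1` (so `h` is not scalar and its
eigenvalues `a, a⁻¹` are distinct). [cite: Serre1972, §2.7 Prop. 17, §2.2 Prop. 14, §2.4 Prop. 15] -/
theorem exists_det_one_eigenvalue_sq_ne_one (hp5 : 5 ≤ p)
    (G : Subgroup (GL (Fin 2) (ZMod p))) {P : GL (Fin 2) (ZMod p)}
    (hPG : halfSplitCartan P ≤ G)
    (hirr : ∀ (v : Fin 2 → ZMod p) (hv : v ≠ 0), ¬ G ≤ eigenvectorStabilizer v hv)
    (hG : G ≠ ⊤) :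
    ∃ h ∈ G, Matrix.GeneralLinearGroup.det h = 1 ∧
      ∃ (a : (ZMod p)ˣ) (v : Fin 2 → ZMod p), v ≠ 0 ∧ a ^ 2 ≠ 1 ∧
        (h : Matrix (Fin 2) (Fin 2) (ZMod p)) *ᵥ v = (a : ZMod p) • v := by
  by_cases h5 : p = 5
  · subst h5
    exact exists_det_one_eigenvalue_sq_ne_one_five G hPG hirr hG
  · exact exists_det_one_eigenvalue_sq_ne_one_of_ne_five hp5 h5 G hPG hirr hG

end Prime

end Summit.BirchSwinnertonDyer.BirchSwinnertonDyer.Rank1Residual.TwistedIm
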